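import Summits.QuantumFields.BalabanUV.Beta.FP.PerfectMaxwellDictPlancherel

/-!
# `BalabanUV.Beta.FP.PerfectMaxwellDictParseval` — road «FP» for binder row D1, leaf H2-P, sub-row H2-P-DICT (optional Parseval supplement): THE PLAIN
# MAXWELL MOMENTUM FORM IN POSITION SPACE and (1.67)'s LOWER HALF FOR THE PERFECT EFFECTIVE LAPLACIAN `Δ_∞` ON THE INFINITE UNIT LATTICE —
# `(4/π²)^{d+3} · ½Σ_{μ≠ν}Σ_z |(∂₁B)_{μν}(z)|² ≤ ⟨B, Δ_∞B⟩` for real finitely supported bond fields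

HONEST DEPENDENCY (page 1, mandatory): continuum YM on T⁴ ⇐ BetaPertH ∧ nine spine estimates (0/9 proved); BetaPertH ⇐ (D1) ∧ (D4) ∧ CAP+tail;
G-an2-4 gates asym, D1 and NE2/3/4.  HONEST FRAMING (cell contract, verbatim): «discharging `BetaPertH` makes Bałaban's UV stability UNCONDITIONAL —
a real constructive-QFT result; it is NOT the continuum limit and NOT the Clay problem.»  THIS MODULE DISCHARGES NOTHING of the wall: [folklore] lattice
Fourier bookkeeping on a finite window (shift of the window transform, Parseval `B5Momentum166Zd.integral_FTsq` BY NAME) + ONE use of this seat's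
`PerfectMaxwellDictPlancherel.form_deltaZLim_ge_maxwell`.  (1.67) of [Balaban1984PropagatorsI] p. 29 («γ₀⟨∂₁B, ∂₁B⟩ ≦ ⟨B, Δ_kB⟩ ≦ γ₁⟨∂₁B, ∂₁B⟩») is
LOCATED, not used: what is proved is its lower half AT `k = ∞` for OUR object `Δ_∞ = deltaZLim` with OUR constant `(4/π²)^{(d+1)+2}` (the tree's
`w166_bounds` inherited through `PerfectSymbol166Pos`).  0 def; no `def … : Prop`; nothing cited as a hypothesis; 0 sorry; 0 wall binders; NOT D1,
NOT BetaPertH, NOT continuum, NOT Clay.  «not in print for Δ_∞; our bookkeeping».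

ABSOLUTE RULE (cell charter, verbatim): «No internally-minted statement may enter as a cited fact. Every hypothesis is either kernel-proved in this package or a
verbatim quotation of a PUBLISHED theorem with page reference. The manuscript(s) under audit are NOT citable for their own disputed steps — they are the thing
under adjudication; programme-internal (2001/route/tribunal) claims are never citable.»

WHAT (every `d`; `S ⊆ T` finite windows of `ℤ^{d+1}` with `S − e_μ ⊆ T` for every direction; `B : ℤ^{d+1} → Fin (d+1) → ℝ` vanishing off `S`;
`B̃_β = FT S (B · β)`, `e μ = B6QGQLower276.e μ` the lattice unit vector; `(∂₁B)_{μν}(z) := (B(z+e_μ,ν) − B(z,ν)) − (B(z+e_ν,μ) − B(z,μ))`):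
* §1 [folklore] window ∕ phase bookkeeping: `FT_congr_window`, `FT_sub`, `phase_e`.
* §2 [folklore] **`d1Sym_mul_FT`** — THE SHIFT: `∂¹_μ(s) · FT T f s = FT T (z ↦ f(z+e_μ) − f(z)) s` (`∂¹_μ(s) = e^{i s_μ} − 1 = d1Sym s μ`; reindexing
  `y ↦ y − e_μ` inside the window, the summand vanishing off `S − e_μ ⊆ T`); **`FT_curl`**: `∂¹_μ B̃_ν − ∂¹_ν B̃_μ = FT T ((∂₁B)_{μν})`.
* §3 **`integral_maxwellQ_one_eq_curlSq`** — `(2π)^{−(d+1)}∫_{BZ} maxwellQ 1 (d1Sym s) (B̃(s)) ds = Σ_μ Σ_{ν≠μ} ½ Σ_{z∈T} |(∂₁B)_{μν}(z)|²`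
  (Parseval `integral_FTsq` per plaquette orientation).
* §4 **`form_deltaZLim_ge_curlSq`** — `(4/π²)^{(d+1)+2} · Σ_μ Σ_{ν≠μ} ½ Σ_{z∈T} |(∂₁B)_{μν}(z)|² ≤ Σ_{x,y∈S}Σ_{α,β} B(x,α)·Δ_∞((x,α),(y,β))·B(y,β)`.
* §5 (v1.1) **`form_deltaZLim_le_curlSq`** (upper half, `(π²/4)^{2(d+1)+4}`), `form_deltaZLim_curlSq_bounds` ((1.67) both halves at `k = ∞`, packaged).
Provenance: G-an2-4 swarm leaf prover 02, gen 34 (prover-b2b-balaban-gan24-formalise-leaf-02-g34-0), cross-lane on road FP's row H2-P-DICT, 2026-08-20.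
-/

noncomputable section

namespace Summit.QuantumFields.BalabanUV.Beta.FP.PerfectMaxwellDictParseval

open MeasureTheory Finset Complex
open scoped BigOperators ComplexConjugate
open Literature.MathematicalPhysics.QuantumFieldTheory.Balaban1983to89
open B4Strip (ofRealVec)
open B4ContourShift (BZ)
open B5Prop11Fiber (d1Sym)
open B5Ineq167SymbolZd (phase phase_sub)
open B6QGQLower276 (X e)
open B5Momentum166Zd (FT FTsq normSq_FT integral_FTsq continuous_FTsq integrableOn_BZ)
open Summit.QuantumFields.BalabanUV.Beta.GAN24.EffectiveLaplacianLimit (deltaZLim)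
open Summit.QuantumFields.BalabanUV.Beta.FP.PerfectSymbol166 (W166Inf)
open Summit.QuantumFields.BalabanUV.Beta.FP.PerfectMaxwellSymbol (maxwellQ)
open Summit.QuantumFields.BalabanUV.Beta.FP.PerfectMaxwellDictPlancherel (form_deltaZLim_ge_maxwell)

variable {d : ℕ}

/-! ## §1 Window and phase bookkeeping -/

/-- [folklore] A field vanishing off `S` has the same window transform on every window `T ⊇ S`. -/
theorem FT_congr_window {S T : Finset (X (d + 1))} {f : X (d + 1) → ℝ} (hS : ∀ y ∉ S, f y = 0) (hST : S ⊆ T)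
    (s : Fin (d + 1) → ℝ) : FT S f s = FT T f s := by
  unfold FT
  exact Finset.sum_subset hST fun y _ hy => by rw [hS y hy]; simp

/-- [folklore] The window transform is subtractive in the field. -/
theorem FT_sub (T : Finset (X (d + 1))) (f g : X (d + 1) → ℝ) (s : Fin (d + 1) → ℝ) :
    FT T (fun z => f z - g z) s = FT T f s - FT T g s := by
  unfold FT
  rw [← Finset.sum_sub_distrib]
  refine Finset.sum_congr rfl fun z _ => ?_
  push_cast
  ring

/-- [folklore] The phase of a lattice unit vector: `s·e_μ = s_μ`. -/
theorem phase_e (s : Fin (d + 1) → ℝ) (μ : Fin (d + 1)) : phase s (e μ) = s μ := by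
  unfold phase e
  simp [Pi.single_apply, Finset.sum_ite_eq']

/-! ## §2 The shift: `∂¹_μ(s)·B̃ = (∂_μB)~` on a window containing `S − e_μ` -/

/-- [folklore] **THE SHIFT OF THE WINDOW TRANSFORM**: for `f` vanishing off `S`, `S ⊆ T`, `S − e_μ ⊆ T`:
`d1Sym s μ · FT T f s = FT T (z ↦ f(z + e_μ) − f z) s` (`d1Sym s μ = e^{i s_μ} − 1` is the symbol of the unit forward difference). -/
theorem d1Sym_mul_FT {S T : Finset (X (d + 1))} {f : X (d + 1) → ℝ} (hS : ∀ y ∉ S, f y = 0) (hST : S ⊆ T) (μ : Fin (d + 1))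
    (hTe : ∀ y ∈ S, y - e μ ∈ T) (s : Fin (d + 1) → ℝ) :
    d1Sym s μ * FT T f s = FT T (fun z => f (z + e μ) - f z) s := by
  -- the pure shift `e^{i s_μ}·FT T f = FT T (f(· + e_μ))`
  have hshift : cexp (((s μ : ℝ) : ℂ) * I) * FT T f s = FT T (fun z => f (z + e μ)) s := by
    unfold FT
    rw [Finset.mul_sum]
    have h1 : ∀ y, cexp (((s μ : ℝ) : ℂ) * I) * ((f y : ℂ) * cexp (((-phase s y : ℝ) : ℂ) * I)) =
        (f ((y - e μ) + e μ) : ℂ) * cexp (((-phase s (y - e μ) : ℝ) : ℂ) * I) := by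
      intro y
      rw [sub_add_cancel, phase_sub, phase_e, ← mul_assoc, mul_comm (cexp _) ((f y : ℂ)), mul_assoc, ← Complex.exp_add]
      congr 2
      push_cast
      ring
    simp_rw [h1]
    -- reindex `z = y − e_μ`
    have h2 : ∑ y ∈ T, (f ((y - e μ) + e μ) : ℂ) * cexp (((-phase s (y - e μ) : ℝ) : ℂ) * I) =
        ∑ z ∈ T.map (Equiv.subRight (e μ)).toEmbedding, (f (z + e μ) : ℂ) * cexp (((-phase s z : ℝ) : ℂ) * I) := by
      rw [Finset.sum_map]
      rfl
    rw [h2]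
    -- both windows carry the same sum: the summand vanishes unless `z + e_μ ∈ S`, and then `z ∈ T` and `z ∈ T − e_μ`
    have hvan : ∀ z, z + e μ ∉ S → (f (z + e μ) : ℂ) * cexp (((-phase s z : ℝ) : ℂ) * I) = 0 :=
      fun z hz => by rw [hS _ hz]; simp
    have hmem : ∀ z, z ∈ T.map (Equiv.subRight (e μ)).toEmbedding ↔ z + e μ ∈ T := fun z => by
      rw [Finset.mem_map_equiv]; simp
    rw [Finset.sum_subset (Finset.subset_union_right (s₁ := T)) fun z _ hz => hvan z fun hzS => hz ((hmem z).2 (hST hzS)),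
      ← Finset.sum_subset (Finset.subset_union_left (s₂ := T.map (Equiv.subRight (e μ)).toEmbedding))
        fun z _ hz => hvan z fun hzS => hz (by simpa using hTe _ hzS)]
  unfold d1Sym
  rw [sub_mul, one_mul, hshift, FT_sub]

/-- [our object] **THE TRANSFORM OF THE LATTICE CURL**: for a bond field `B` vanishing off `S`, `S ⊆ T`, `S − e_μ ⊆ T` for every `μ`,
`∂¹_μ(s)·B̃_ν(s) − ∂¹_ν(s)·B̃_μ(s) = FT T ((∂₁B)_{μν}) s` with `(∂₁B)_{μν}(z) = (B(z+e_μ,ν) − B(z,ν)) − (B(z+e_ν,μ) − B(z,μ))`. -/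
theorem FT_curl {S T : Finset (X (d + 1))} {B : X (d + 1) → Fin (d + 1) → ℝ} (hS : ∀ y ∉ S, ∀ β, B y β = 0) (hST : S ⊆ T)
    (hTe : ∀ μ, ∀ y ∈ S, y - e μ ∈ T) (μ ν : Fin (d + 1)) (s : Fin (d + 1) → ℝ) :
    d1Sym s μ * FT S (fun y => B y ν) s - d1Sym s ν * FT S (fun y => B y μ) s =
      FT T (fun z => (B (z + e μ) ν - B z ν) - (B (z + e ν) μ - B z μ)) s := by
  rw [FT_congr_window (fun y hy => hS y hy ν) hST, FT_congr_window (fun y hy => hS y hy μ) hST,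
    d1Sym_mul_FT (fun y hy => hS y hy ν) hST μ (hTe μ) s, d1Sym_mul_FT (fun y hy => hS y hy μ) hST ν (hTe ν) s,
    ← FT_sub]

/-! ## §3 The plain Maxwell momentum form in position space -/

/-- [our object] **PARSEVAL FOR THE PLAIN MAXWELL FORM**: `(2π)^{−(d+1)} ∫_{BZ} maxwellQ 1 (d1Sym s) (B̃(s)) ds = Σ_μ Σ_{ν≠μ} ½ Σ_{z∈T} |(∂₁B)_{μν}(z)|²`
(= `½Σ_{μ,ν}Σ_x|(∂₁B)_{μν}(x)|²` of (1.66)–(1.67), the `x`-sum read on the window `T`, off which the curl vanishes). -/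
theorem integral_maxwellQ_one_eq_curlSq {S T : Finset (X (d + 1))} {B : X (d + 1) → Fin (d + 1) → ℝ} (hS : ∀ y ∉ S, ∀ β, B y β = 0)
    (hST : S ⊆ T) (hTe : ∀ μ, ∀ y ∈ S, y - e μ ∈ T) :
    ((2 * Real.pi) ^ (d + 1))⁻¹ * ∫ s in BZ (d + 1), maxwellQ (fun _ _ => (1 : ℝ)) (d1Sym s) (fun β => FT S (fun y => B y β) s) =
      ∑ μ : Fin (d + 1), ∑ ν : Fin (d + 1), if μ = ν then 0 else
        (1 / 2) * ∑ z ∈ T, ((B (z + e μ) ν - B z ν) - (B (z + e ν) μ - B z μ)) ^ 2 := by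
  have hc : (0 : ℝ) < (2 * Real.pi) ^ (d + 1) := by positivity
  -- pointwise: each plaquette term is `½·FTsq T ((∂₁B)_{μν}) s`
  have hpt : ∀ s : Fin (d + 1) → ℝ, maxwellQ (fun _ _ => (1 : ℝ)) (d1Sym s) (fun β => FT S (fun y => B y β) s) =
      ∑ μ : Fin (d + 1), ∑ ν : Fin (d + 1), if μ = ν then 0 else
        (1 / 2) * FTsq T (fun z => (B (z + e μ) ν - B z ν) - (B (z + e ν) μ - B z μ)) s := by
    intro s
    unfold maxwellQ
    refine Finset.sum_congr rfl fun μ _ => Finset.sum_congr rfl fun ν _ => ?_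
    split_ifs with h
    · rfl
    · rw [FT_curl hS hST hTe μ ν s, ← Complex.normSq_eq_norm_sq, normSq_FT, mul_one]
  simp_rw [hpt]
  have hint : ∀ μ ν : Fin (d + 1), IntegrableOn (fun s : Fin (d + 1) → ℝ => if μ = ν then (0 : ℝ) else
      (1 / 2) * FTsq T (fun z => (B (z + e μ) ν - B z ν) - (B (z + e ν) μ - B z μ)) s) (BZ (d + 1)) := by
    intro μ ν
    by_cases h : μ = ν
    · simp only [h, if_true]; exact integrableOn_BZ continuous_const
    · simp only [h, if_false]; exact integrableOn_BZ (continuous_const.mul (continuous_FTsq T _))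
  rw [integral_finsetSum _ fun μ _ => integrable_finsetSum _ fun ν _ => hint μ ν, Finset.mul_sum]
  refine Finset.sum_congr rfl fun μ _ => ?_
  rw [integral_finsetSum _ fun ν _ => hint μ ν, Finset.mul_sum]
  refine Finset.sum_congr rfl fun ν _ => ?_
  by_cases h : μ = ν
  · simp [h]
  · simp only [h, if_false]
    rw [integral_const_mul, integral_FTsq, ← mul_assoc, ← mul_assoc, mul_comm (((2 * Real.pi) ^ (d + 1))⁻¹) (1 / 2), mul_assoc (1 / 2),
      inv_mul_cancel₀ hc.ne', mul_one]

/-! ## §4 (1.67), lower half, for `Δ_∞` in position space -/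

/-- [our object] **THE PERFECT EFFECTIVE LAPLACIAN DOMINATES THE CURL FORM**: for `B` vanishing off `S`, `S ⊆ T`, `S − e_μ ⊆ T` (all `μ`),
`(4/π²)^{(d+1)+2} · Σ_μ Σ_{ν≠μ} ½ Σ_{z∈T} |(∂₁B)_{μν}(z)|² ≤ Σ_{x,y∈S} Σ_{α,β} B(x,α)·Δ_∞((x,α),(y,β))·B(y,β)` — the lower half of (1.67) at `k = ∞`
for OUR `Δ_∞`, with OUR constant (`PerfectMaxwellDictPlancherel.form_deltaZLim_ge_maxwell` + §3). -/
theorem form_deltaZLim_ge_curlSq {S T : Finset (X (d + 1))} {B : X (d + 1) → Fin (d + 1) → ℝ} (hS : ∀ y ∉ S, ∀ β, B y β = 0)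
    (hST : S ⊆ T) (hTe : ∀ μ, ∀ y ∈ S, y - e μ ∈ T) :
    (4 / Real.pi ^ 2) ^ (d + 1 + 2) * ∑ μ : Fin (d + 1), ∑ ν : Fin (d + 1), (if μ = ν then 0 else
        (1 / 2) * ∑ z ∈ T, ((B (z + e μ) ν - B z ν) - (B (z + e ν) μ - B z μ)) ^ 2) ≤
      ∑ x ∈ S, ∑ y ∈ S, ∑ α, ∑ β, B x α * deltaZLim (d := d) (x, α) (y, β) * B y β := by
  rw [← integral_maxwellQ_one_eq_curlSq hS hST hTe]
  exact form_deltaZLim_ge_maxwell S B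

/-! ## §5 (v1.1) (1.67), upper half, for `Δ_∞` in position space -/

/-- [our object] **THE CURL FORM DOMINATES THE PERFECT EFFECTIVE LAPLACIAN**: for `B` vanishing off `S`, `S ⊆ T`, `S − e_μ ⊆ T` (all `μ`),
`Σ_{x,y∈S} Σ_{α,β} B(x,α)·Δ_∞((x,α),(y,β))·B(y,β) ≤ (π²/4)^{2(d+1)+4} · Σ_μ Σ_{ν≠μ} ½ Σ_{z∈T} |(∂₁B)_{μν}(z)|²` — with §4, BOTH halves of (1.67)
«γ₀⟨∂₁B, ∂₁B⟩ ≦ ⟨B, Δ_kB⟩ ≦ γ₁⟨∂₁B, ∂₁B⟩» hold AT `k = ∞` for OUR `Δ_∞` with OUR constants `γ₀ = (4/π²)^{d+3}`, `γ₁ = (π²/4)^{2d+6}`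
(`PerfectMaxwellDictPlancherel.form_deltaZLim_le_maxwell` v1.1 + §3). -/
theorem form_deltaZLim_le_curlSq {S T : Finset (X (d + 1))} {B : X (d + 1) → Fin (d + 1) → ℝ} (hS : ∀ y ∉ S, ∀ β, B y β = 0)
    (hST : S ⊆ T) (hTe : ∀ μ, ∀ y ∈ S, y - e μ ∈ T) :
    ∑ x ∈ S, ∑ y ∈ S, ∑ α, ∑ β, B x α * deltaZLim (d := d) (x, α) (y, β) * B y β ≤
      (Real.pi ^ 2 / 4) ^ (2 * (d + 1) + 4) * ∑ μ : Fin (d + 1), ∑ ν : Fin (d + 1), (if μ = ν then 0 else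
        (1 / 2) * ∑ z ∈ T, ((B (z + e μ) ν - B z ν) - (B (z + e ν) μ - B z μ)) ^ 2) := by
  rw [← integral_maxwellQ_one_eq_curlSq hS hST hTe]
  exact PerfectMaxwellDictPlancherel.form_deltaZLim_le_maxwell S B

/-- [our object] **(1.67) AT `k = ∞`, BOTH HALVES, POSITION SPACE** — packaged. -/
theorem form_deltaZLim_curlSq_bounds {S T : Finset (X (d + 1))} {B : X (d + 1) → Fin (d + 1) → ℝ} (hS : ∀ y ∉ S, ∀ β, B y β = 0)
    (hST : S ⊆ T) (hTe : ∀ μ, ∀ y ∈ S, y - e μ ∈ T) :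
    (4 / Real.pi ^ 2) ^ (d + 1 + 2) * ∑ μ : Fin (d + 1), ∑ ν : Fin (d + 1), (if μ = ν then 0 else
        (1 / 2) * ∑ z ∈ T, ((B (z + e μ) ν - B z ν) - (B (z + e ν) μ - B z μ)) ^ 2) ≤
      ∑ x ∈ S, ∑ y ∈ S, ∑ α, ∑ β, B x α * deltaZLim (d := d) (x, α) (y, β) * B y β ∧
    ∑ x ∈ S, ∑ y ∈ S, ∑ α, ∑ β, B x α * deltaZLim (d := d) (x, α) (y, β) * B y β ≤
      (Real.pi ^ 2 / 4) ^ (2 * (d + 1) + 4) * ∑ μ : Fin (d + 1), ∑ ν : Fin (d + 1), (if μ = ν then 0 else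
        (1 / 2) * ∑ z ∈ T, ((B (z + e μ) ν - B z ν) - (B (z + e ν) μ - B z μ)) ^ 2) :=
  ⟨form_deltaZLim_ge_curlSq hS hST hTe, form_deltaZLim_le_curlSq hS hST hTe⟩

end Summit.QuantumFields.BalabanUV.Beta.FP.PerfectMaxwellDictParseval

end
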